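import Mathlib.LinearAlgebra.Matrix.PosDef
import Literature.MathematicalPhysics.QuantumFieldTheory.Balaban1983to89.B9Cor35GDirInputsAtOne
import Literature.MathematicalPhysics.QuantumFieldTheory.Balaban1983to89.B9CubeDirichletCLetterAtOne
import Literature.MathematicalPhysics.QuantumFieldTheory.Balaban1983to89.B9LocalGaugeZeroModesY
import Literature.MathematicalPhysics.QuantumFieldTheory.Balaban1983to89.B6ScalarChartV1L0
import Literature.MathematicalPhysics.QuantumFieldTheory.Balaban1983to89.B9CubeLettersCovarianceL0

/-!
# `Balaban1983to89.B9CubeDirInverseBondSocketAtOne` — [Balaban1985BackgroundPropagators] p. 395 («it can be easily shown that the operator Δ′_a is positive. This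
# implies positivity of the operators G′, Q′G′²Q′*, hence the existence of the operator R»), (3.25)–(3.27) pp. 394–395, p. 409 l. 3–5 («G_□(U)»), Cor. 3.5 p. 407
# («for U = 1 … proved in [4]»); [4] = [Balaban1984PropagatorsII] p. 226 («the operator Δ_a is bounded from below by a positive constant»), p. 228: ★★★ THE BOND
# SOCKET `hKB` OF ROAD (B5) DISCHARGED — the compression of the canonical `U = 1` Dirichlet bond operator `M_□(1) := mDirC i □` of the cube sequence to the bonds
# over `Ω₀(□)` IS INVERTIBLE, with inverse the canonical kernel `kDirC i □`; indeed `M_□(1)` is POSITIVE DEFINITE on all bond functions of the member torus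

statement-level skeleton of published theorems with citation tags; proofs where landed; nothing here is a claim about the Yang–Mills mass gap

CITATION HEADER (lean-in-tree rule).  B9 = T. Bałaban, *Propagators for lattice gauge theories in a background field*, Commun. Math. Phys. **99** (1985) 389–434
[Balaban1985BackgroundPropagators] (held `paper:balaban1985-cmp99-background-propagators`; journal page = PDF page + 388; pp. 394–396, 408–409 re-read on the text layer
this session): p. 394 (3.21) «R = R(U) is an orthogonal projection in the Hilbert space L²(Ω₀, g)», «By the definition of space N(Q′) the functions λ in (3.22) vanish on
Ω₁ᶜ. This permits us to express R in terms of operators with some boundary conditions … We will use only Dirichlet boundary conditions», (3.25) «R = I − G′Q′*(Q′G′²Q′*)⁻¹Q′G′»,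
p. 395 (quoted in the title), (3.26) «Δ_a = Δ + DRD* + Q*aQ. It coincides with Δ_a in (2.19) if U = 1», (3.27) «G = (Δ_a↾Ω₀)⁻¹»; p. 409 l. 3–5 «The operators constructed for
this sequence, which we denote by G′_□(U), C_□(U) = (Q′(U)G′_□²(U)Q′*(U))⁻¹, G_□(U)»; Cor. 3.5 p. 407.  [4] = T. Bałaban, *Propagators and renormalization transformations
for lattice gauge theories. II*, Commun. Math. Phys. **96** (1984) 223–250 [Balaban1984PropagatorsII]: (2.7) p. 224 «λ = 0 on Λ₀, Q′_jλ = 0 on Λ_j», (2.17)–(2.19)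
pp. 225–226, p. 226 «One of our main results will be that the operator Δ_a is bounded from below by a positive constant», p. 228 «The only assumption we have used was
the positivity of the operator Δ_a».  Rows B9.Eq3.27 × B9.Cor3.5 × B6.Eq2.19 (cells only; no row head changes).

WHY THIS FILE (cell `pub-ymgap`, Track A node N06 [B9], seat `pub-ymgap-dag-n06-c` g35, helper lane `--supports stmt-QuantumFields-27239`).  Road (B5) (the Dirichlet bond
letter of record `G_□(U)`, director-ym №606) reads print's `G_□(1)` as the lift of a real kernel `𝟙_B K_B 𝟙_B` GIVEN a real matrix `K_B` inverting the compression of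
the flat operator `M_□(1) = mDirC i □` (✓`B9Cor35GDirInputsAtOne` §3: `Δ_{loc,□}(1) − D P_□(1) D*` of the cube sequence `{Ω_n(□)}` at its own averaging pair, LOCATED-34)
to `B = bondsOverY Ω₀(□)` — the hypothesis `hKB` displayed by ✓`thm33_GdK_cube_of_prop26Dirichlet`, ✓`B9Cor35GDirKnitInputsAtOne.thm33_GiK_knit_of_prop26Dirichlet`,
✓`B9Cor36GDirKnitAtCutField.gDir_knit_at_cutField`, ✓`B9Cor36GDirKnitEntriesAtCutField.gDir_knit_entries_at_cutField` and ✓`B9Cor36GDirKnitRowsAtMemberY.cubeRowsGDirCY_at_member`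
(there: `∀ □, ∃ KB, (mDirC x.toKIdx □)|_{B×B}·KB|_{B×B} = 1`), hence by dag-n06-d's heads «KE₂₁X-C» ∕ «ZK₉».  `hKB` is `U`-INDEPENDENT: it is print's sentence quoted in the
title at `U = 1` for the sequence `{Ω_n(□)}` — positivity of `Δ′_{a,□}(1)` gives `G′_□(1)`, `(Q′G′_□(1)²Q′*)⁻¹` and the projection `R_□ = 1 − P_□`; then (3.26) is a sum
of squares, and its kernel is killed by [4] Sect. A's zero-mode theorem (r03's ✓`B6SectAZeroModesV1.exists_inGauge_grad_of_curl_eq_zero`, for ANY V1 domain structure,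
here the cube sequence's ✓`B9CubeBondWeights.domCube i □`) together with the Dirichlet structure «the functions λ ∈ N(Q′) vanish on Ω₁ᶜ» (the level-`0` exterior of the cube
family lies outside `Ω₀(□)`'s complement: g31's ✓`B9CubeSequence408Mirrors.mem_dirDomC_of_lev_pos`).  THIS FILE proves it: `K_B := kDirC i □` (the canonical kernel of the
same §3) inverts the compression, for every member index `i` and cover cube `□`, under `0 < b₀` only (positivity of the cube sequence's bond weights, ✓`wCubeBond_pos`).

WHAT IS PROVED (0 `sorry`, 0 `def`, 0 new named facts; axioms `propext ∕ Classical.choice ∕ Quot.sound`; every `i : KIdx`, every cover cube `□`).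
* §1 `mSite_transpose`, ★`GpDirOneY_transpose` (`G′_□(1)ᵀ = G′_□(1)`: uniqueness of the two-sided inverse of the symmetric compression `Ω₀Δ′_{a,□}(1)Ω₀`, g31's
  ✓`compress_mul_GpDirOneY` + r05's ✓`mlOpT_isSymm`), `indDiagY_mul_apply ∕ mul_indDiagY_apply ∕ sum_eq_sum_subtype_of_zero` (bookkeeping), ★`indDiagY_mul_mSite_mul_GpDirOneY`
  (the left resolvent identity `𝟙_{Ω₀}·Δ′_{a,□}(1)·G′_□(1) = 𝟙_{Ω₀}` on the member torus).
* §2 `kxDirC_eq_kxDirY` (the canonical block inverse `invOnB 𝔖 X` IS g33's explicit signed-image `K_X`, ✓`B9CubeDirichletCLetterAtOne.hKX_dirDomY`), `compr_kxDirC`,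
  `indDiagY_mul_kxDirC`, `kxDirC_mul_indDiagY`, `compress_xDirMatY_mul_kxDirC`, ★`comprX_mul_kxDirC` (the padded laws `(𝟙_𝔖X𝟙_𝔖)K_X = 𝟙_𝔖 = K_X(𝟙_𝔖X𝟙_𝔖)`),
  `kxDirC_mul_X_mul_kxDirC`, `diagW_mul_diagWinv`, `xDirMatY_transpose_mul_diagW` ∕ ★`kxDirC_transpose_mul_diagW` (`X = Q′G′²Q′*` and `K_X` are `diag(W)`-symmetric:
  `Q′*ᵀ = diag(W)Q′`, r05's ✓`QsM_transpose ∕ QM_eq_diag_mul` for the cube family).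
* §3 `pDirMatY_dirDomY_eq` (`P_□(1) = G′·Q′*·K_X·Q′·G′` at the canonical letters), ★★`pDir_mul_pDir` (`P_□(1)² = P_□(1)`), ★★`pDir_transpose` (`P_□(1)ᵀ = P_□(1)`) — print's
  «R is an orthogonal projection» (3.21)∕(3.25), at the Dirichlet letters (r05's global ✓`B6Ineq288MultiLevelTorusL0.pM_mul_pM ∕ pM_transpose` pattern).
* §4 `aKc_mulVec`, `aKc_transpose` (r05's ✓`B9CubeLettersCovarianceL0.qsKc_eq_transpose ∕ aKc_eq_diagonal` by name), `gradK_eq_transpose`, `dotProduct_pDir_mulVec_self`, ★★`dotProduct_mDirC_mulVec` (THE QUADRATIC FORM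
  `⟨v, M_□(1)v⟩ = ‖∂v‖² + ‖(1 − P_□)∂*v‖² + Σ_{𝔅_□} w_□(Q_□v)²`, print's (3.26) read at `U = 1`), `dotProduct_mDirC_mulVec_nonneg`, `mDirC_transpose`.
* §5 `qKc_mulVec_eq_zero_iff`, ★`exists_potential_of_curlK_qKc` ([4] Sect. A's zero modes FOR THE CUBE SEQUENCE, supported: `∂v = 0 ∧ Q_□v = 0 ⇒ v = ∂φ`, `φ ∈ N(Q′_□)`,
  `φ = 0` off `Ω₀(□)` — r03's theorem at `domCube` through p22∕r03's L0 dictionary ✓`B6ScalarChartV1L0.inGauge_chart_iff ∕ lamSite_domT_iff` and n06-j's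
  ✓`curlK_mulVec ∕ gradK_mulVec_chart`), `indDiagY_mulVec_of_support`, `dotProduct_indDiagY_mulVec`, ★★★`eq_zero_of_dotProduct_mDirC_mulVec_eq_zero`
  (`⟨v, M_□(1)v⟩ = 0 ⇒ v = 0`: the squares vanish, `v = ∂φ`, `∂*v = c_f²Δ′_{a,□}(1)φ ∈ range P_□ = G′_□(1)·range Q′*_□` is `⟨φ, ·⟩`-null while §1's resolvent identity
  gives `⟨φ, ·⟩ = c_f²‖Δ′_{a,□}(1)φ‖²`, so `φ = 0` by r05's ✓`mlOpT_mulVec_injective`), ★★★`mDirC_posDef` (`(mDirC i □).PosDef`, Mathlib).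
* §6 `compress_mDirC_posDef` (every principal compression is positive definite), ★★★`compress_mDirC_mul_kDirC`
  (`(mDirC i □).submatrix val val * (kDirC i □).submatrix val val = 1` on `↥(bondsOverY i Ω₀(□))` — LITERALLY `hKB` with `KB := kDirC i □`), `compress_kDirC_mul_mDirC`
  (the other order), ★`exists_bondSocket` (`∀ □, ∃ KB, …`, the heads' shape per member `i := x.toKIdx`).

HONEST SCOPE ∕ NOT CLAIMED.  Finite-dimensional positivity algebra at `U = 1` over landed theorems (the analytic input is [4] Sect. A's zero-mode theorem, r03's, applied to
the cube sequence's V1 domain structure); no inequality of [B9] (Thms 3.1–3.3 ∕ Cor. 3.6 at `U ≠ 1`, the decay of `G_□`) is asserted; the named fact `B6.Prop26DirichletPrinted`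
of road (B5) is untouched (this file removes the OTHER displayed input, the socket `hKB`, unconditionally for `b₀ > 0`).  NOT a node discharge; count-neutral
(`--supports stmt-QuantumFields-27239`); N06 NOT discharged; nothing on `d = 4`, the continuum, reflection positivity, OS or the mass gap; the Yang–Mills mass gap is
NOT proved here.  NEW file; nothing landed is modified; no `sorry`, no `axiom`, no `instance`, no `notation`, no `def`.  Seat `pub-ymgap-dag-n06-c` (g35), 2026-08-31.

RELATED IN THE TREE, NOT DUPLICATED (searched 2026-08-31: `rg -l -w 'GpDirOneY_transpose|pDir_mul_pDir|pDir_transpose|mDirC_posDef|compress_mDirC_mul_kDirC|kxDirC_transpose_mul_diagW'`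
over `Literature/MathematicalPhysics` + `Summits/QuantumFields` = ∅): r05's GLOBAL torus projection algebra ✓`B6Ineq288MultiLevelTorusL0` (`pM_mul_pM ∕ pM_transpose ∕ rM_…`,
the member's `Δ′_a⁻¹` on the whole torus — here the DIRICHLET letters `G′_□(1) = GpDirOneY`, `K_X = kxDirC`); r03's ✓`B6SectAVectorModelV1.deltaAE_pos` (the GLOBAL `Δ_a` of a
V1 family is positive definite — here the Dirichlet-compressed `Δ_{a,□}(1)` of [B9] (3.26)–(3.27), whose `R_□` is built from Dirichlet inverses); n06-j's
✓`B9LocalGaugeZeroModesY` (the same transport for the MEMBER's family `i.D`; here for the cube family `cubeFamY i □` ∕ `domCube i □`, consumed by name where `D`-free);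
n06-d's ✓`B9CubeDirInversePosOnNearHY` (the SITE-sector analogue: `IsUnit padΔ′_{a,□}` from positivity of `Δ′_a`); g33's ✓`B9CubeDirichletCLetterAtOne.hKX_dirDomY`
(the block socket `hKX`, USED).
-/

noncomputable section

namespace Literature.MathematicalPhysics.QuantumFieldTheory.Balaban1983to89.B9CubeDirInverseBondSocketAtOne

open Literature.MathematicalPhysics.QuantumFieldTheory.Balaban1983to89.B6KLevelCensusIndexV1 (KIdx)
open Literature.MathematicalPhysics.QuantumFieldTheory.Balaban1983to89.B6Cover236MultiLevelBlocks (cubes)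
open Literature.MathematicalPhysics.QuantumFieldTheory.Balaban1983to89.B6MultiLevelTorusOperator (mlOpT mlOpT_isSymm perLapT mlOpT_mulVec_injective)
open Literature.MathematicalPhysics.QuantumFieldTheory.Balaban1983to89.B6Geom246MultiLevelBoxL0 (bset blkOf)
open Literature.MathematicalPhysics.QuantumFieldTheory.Balaban1983to89.B6Ineq268MultiLevelBoxL0 (W W_pos QB)
open Literature.MathematicalPhysics.QuantumFieldTheory.Balaban1983to89.B6Ineq288MultiLevelTorusL0 (QM QsM QsM_transpose QM_eq_diag_mul QB_eq_QM_mulVec)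
open Literature.MathematicalPhysics.QuantumFieldTheory.Balaban1983to89.B9Thm31CubeLocalFlat (wCube wCube_pos)
open Literature.MathematicalPhysics.QuantumFieldTheory.Balaban1983to89.B9CubeLettersOpsL0 (cubeFamY oddMh)
open Literature.MathematicalPhysics.QuantumFieldTheory.Balaban1983to89.B9CubeLettersBondOpsL0 (BlkCubeY IBondCubeY qKc qsKc aKc qpKc qpsKc)
open Literature.MathematicalPhysics.QuantumFieldTheory.Balaban1983to89.B9Cor35GpDirInputsAtOne (dirDomY GpDirOneY compr_GpDirOneY)
open Literature.MathematicalPhysics.QuantumFieldTheory.Balaban1983to89.B9CubeDirichletLetterAtOne (compress_mul_GpDirOneY GpDirOne_apply_of_not_mem_left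
  GpDirOne_apply_of_not_mem_right)
open Literature.MathematicalPhysics.QuantumFieldTheory.Balaban1983to89.B9CubeDirichletCLetterAtOne (kxDirY hKX_dirDomY xDirMatY_dirDomY_eq kxDirY_apply_of_not)
open Literature.MathematicalPhysics.QuantumFieldTheory.Balaban1983to89.B9Cor35GDirInputsAtOne (invOnB invOnB_apply_of_mem invOnB_apply_of_not compr_invOnB
  compr_eq_invOnB kxDirC mDirC kDirC)
open Literature.MathematicalPhysics.QuantumFieldTheory.Balaban1983to89.B9Eq3105DirichletBondLettersAtOneY (xDirMatY pDirMatY mlocDirCMatY deltaLocCubeMatY)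
open Literature.MathematicalPhysics.QuantumFieldTheory.Balaban1983to89.Node00 (SiteY FBondY toKT gradK divK curlK cocurlK divK_eq_transpose cocurlK_eq_transpose)
open Literature.MathematicalPhysics.QuantumFieldTheory.Balaban1983to89.Node00.OpsYCubeDirInverse (indDiagY indDiagY_apply indDiagY_mul_indDiagY compr_apply
  indDiagY_mulVec_apply compr_mul_compr_eq_indDiagY)
open Literature.MathematicalPhysics.QuantumFieldTheory.Balaban1983to89.Node00.OpsYCubeDirInverseBond (bondsOverY)
open Literature.MathematicalPhysics.QuantumFieldTheory.Balaban1983to89.Node00.OpsYCubeProjectionG (insideBlkY mem_insideBlkY_iff)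
open Literature.MathematicalPhysics.QuantumFieldTheory.Balaban1983to89.B9CubeBondWeights (domCube wCubeBond wCubeBond_pos)
open Literature.MathematicalPhysics.QuantumFieldTheory.Balaban1983to89.B9CubeLettersCovarianceL0 (qsKc_eq_transpose aKc_eq_diagonal)
open Literature.MathematicalPhysics.QuantumFieldTheory.Balaban1983to89.B9CubeSequence408Mirrors (mem_dirDomC_of_lev_pos)
open Literature.MathematicalPhysics.QuantumFieldTheory.Balaban1983to89.B9LocalGaugeZeroModesY (curlK_mulVec gradK_mulVec_chart divK_gradK_mulVec)
open Literature.MathematicalPhysics.QuantumFieldTheory.Balaban1983to89.B6ScalarChartV1 (toBox_boxEquiv_symm)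
open Literature.MathematicalPhysics.QuantumFieldTheory.Balaban1983to89.B6GlobalChartV1 (PV boxEquiv toBox boxEquiv_apply)
open Literature.MathematicalPhysics.QuantumFieldTheory.Balaban1983to89.B6AgreeLapV1Chart (toMatrix'_onFun_adjoint)
open Literature.MathematicalPhysics.QuantumFieldTheory.Balaban1983to89.B6Ineq2133TwoScaleV1 (onFun onFun_apply)
open Literature.MathematicalPhysics.QuantumFieldTheory.Balaban1983to89.B6SectAOperatorsV1 (QE QsE aE QE_eq_zero_iff aE_apply)
open Literature.MathematicalPhysics.QuantumFieldTheory.Balaban1983to89.B6SectAZeroModesV1 (exists_inGauge_grad_of_curl_eq_zero)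
open Literature.MathematicalPhysics.QuantumFieldTheory.Balaban1983to89.B6MultiLevelTorusOperator (one_le_N0)
open Literature.MathematicalPhysics.QuantumFieldTheory.Balaban1983to89.B5Eq118OneStroke (iterBlockOf iterBlockOf_zero)
open Literature.MathematicalPhysics.QuantumFieldTheory.Balaban1983to89.Node00.OpsYNablaBridge (chartY)
open LatticeFieldCalculus (grad curl bondAvgIter siteAvgIter)
open scoped Matrix

variable {d ℓ : ℕ} {hd : 1 ≤ d + 1} {hL : Odd (ℓ + 1) ∧ 1 < ℓ + 1} {b₀ b₁ : ℝ}
variable (i : KIdx d ℓ hd hL b₀ b₁) (q : ↥(cubes (toKT i).D.toDomains))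

/-! ## §1  The Dirichlet site letter `G′_□(1)` is symmetric; the left resolvent identity `𝟙_{Ω₀}·Δ′_{a,□}(1)·G′_□(1) = 𝟙_{Ω₀}` -/

/-- the cube family's site operator `Δ′_{a,□}(1)` is a symmetric matrix. [cite: Balaban1984PropagatorsII, (2.13) p.225 («Δ′_a»); Balaban1985BackgroundPropagators, p.394] -/
theorem mSite_transpose :
    (mlOpT (toKT i).NB ℓ (toKT i).k (cubeFamY i q).lev (wCube ℓ))ᵀ = mlOpT (toKT i).NB ℓ (toKT i).k (cubeFamY i q).lev (wCube ℓ) :=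
  (mlOpT_isSymm ℓ (toKT i).k (cubeFamY i q).lev (wCube ℓ)).eq

/-- ★ **`G′_□(1)ᵀ = G′_□(1)`**: the Dirichlet inverse of the symmetric compression `Ω₀Δ′_{a,□}(1)Ω₀` is symmetric (uniqueness of the two-sided inverse),
and both vanish off `Ω₀(□) × Ω₀(□)`. [cite: Balaban1985BackgroundPropagators, p.394 («Its inverse is denoted by G′»), p.395 («positivity of the operators G′»)] -/
theorem GpDirOneY_transpose : (GpDirOneY i q)ᵀ = GpDirOneY i q := by
  have hMK := compress_mul_GpDirOneY i q
  -- the compressions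
  set MS := (mlOpT (toKT i).NB ℓ (toKT i).k (cubeFamY i q).lev (wCube ℓ)).submatrix
      (fun v : ↥(dirDomY i q) => (v : SiteY i)) (fun v : ↥(dirDomY i q) => (v : SiteY i)) with hMS
  set KS := (GpDirOneY i q).submatrix (fun v : ↥(dirDomY i q) => (v : SiteY i)) (fun v : ↥(dirDomY i q) => (v : SiteY i)) with hKS
  have hMSt : MSᵀ = MS := by
    rw [hMS, Matrix.transpose_submatrix, mSite_transpose]
  have hKinv : MS⁻¹ = KS := Matrix.inv_eq_right_inv hMK
  have hKSt : KSᵀ = KS := by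
    rw [← hKinv, Matrix.transpose_nonsing_inv, hMSt]
  ext z w
  rw [Matrix.transpose_apply]
  by_cases hz : z ∈ dirDomY i q
  · by_cases hw : w ∈ dirDomY i q
    · have := congrFun (congrFun hKSt ⟨z, hz⟩) ⟨w, hw⟩
      rw [Matrix.transpose_apply] at this
      exact this
    · have h1 : GpDirOneY i q w z = 0 := GpDirOne_apply_of_not_mem_left hw _
      have h2 : GpDirOneY i q z w = 0 := GpDirOne_apply_of_not_mem_right _ hw
      rw [h1, h2]
  · have h1 : GpDirOneY i q w z = 0 := GpDirOne_apply_of_not_mem_right _ hz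
    have h2 : GpDirOneY i q z w = 0 := GpDirOne_apply_of_not_mem_left hz _
    rw [h1, h2]

/-- a sum over all sites of a function vanishing off `S` is the sum over `↥S` (reading `Ω₀` as a characteristic function). [cite: Balaban1985BackgroundPropagators, p.394 («Ω₀ denotes a characteristic function of Ω₀»), bookkeeping] -/
theorem sum_eq_sum_subtype_of_zero {X : Type} [Fintype X] (S : Finset X) (f : X → ℝ) (hf : ∀ x, x ∉ S → f x = 0) :
    ∑ x, f x = ∑ x : ↥S, f x := by
  classical
  rw [Finset.sum_coe_sort S f]
  exact (Finset.sum_subset (Finset.subset_univ S) (fun x _ hx => hf x hx)).symm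

/-- the rows of `𝟙_S·N`. [cite: Balaban1985BackgroundPropagators, p.394 («Ω₀Δ′_aΩ₀»), bookkeeping] -/
theorem indDiagY_mul_apply {Y Z : Type} [Fintype Y] [DecidableEq Y] (S : Finset Y) (N : Matrix Y Z ℝ) (y : Y) (x : Z) :
    ((indDiagY S : Matrix Y Y ℝ) * N) y x = if y ∈ S then N y x else 0 := by
  rw [indDiagY, Matrix.diagonal_mul]
  split_ifs <;> simp

/-- the columns of `N·𝟙_S`. [cite: Balaban1985BackgroundPropagators, p.394 («Ω₀Δ′_aΩ₀»), bookkeeping] -/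
theorem mul_indDiagY_apply {Y Z : Type} [Fintype Y] [DecidableEq Y] (S : Finset Y) (N : Matrix Z Y ℝ) (x : Z) (y : Y) :
    (N * (indDiagY S : Matrix Y Y ℝ)) x y = if y ∈ S then N x y else 0 := by
  rw [indDiagY, Matrix.mul_diagonal]
  split_ifs <;> simp

/-- ★ **THE LEFT RESOLVENT IDENTITY `𝟙_{Ω₀}·Δ′_{a,□}(1)·G′_□(1) = 𝟙_{Ω₀}`** on the member's torus: the rows of `Δ′_{a,□}(1)G′_□(1)` at the sites of `Ω₀(□)` are those
of the identity (the columns off `Ω₀(□)` vanish because `G′_□(1)` does). [cite: Balaban1985BackgroundPropagators, p.394 («Ω₀Δ′_aΩ₀ … Its inverse is denoted by G′»)] -/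
theorem indDiagY_mul_mSite_mul_GpDirOneY :
    indDiagY (dirDomY i q) * (mlOpT (toKT i).NB ℓ (toKT i).k (cubeFamY i q).lev (wCube ℓ) * GpDirOneY i q) = indDiagY (dirDomY i q) := by
  classical
  have hMK := compress_mul_GpDirOneY i q
  ext y x
  rw [indDiagY_apply, indDiagY_mul_apply]
  by_cases hy : y ∈ dirDomY i q
  · rw [if_pos hy, Matrix.mul_apply]
    by_cases hx : x ∈ dirDomY i q
    · have h := congrFun (congrFun hMK ⟨y, hy⟩) ⟨x, hx⟩
      rw [Matrix.mul_apply, Matrix.one_apply] at h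
      simp only [Matrix.submatrix_apply] at h
      have hvan : ∀ z, z ∉ dirDomY i q → mlOpT (toKT i).NB ℓ (toKT i).k (cubeFamY i q).lev (wCube ℓ) y z * GpDirOneY i q z x = 0 := by
        intro z hz
        have h0 : GpDirOneY i q z x = 0 := GpDirOne_apply_of_not_mem_left hz _
        rw [h0, mul_zero]
      rw [sum_eq_sum_subtype_of_zero (dirDomY i q) _ hvan, h]
      by_cases hyx : y = x
      · subst hyx; rw [if_pos rfl, if_pos ⟨rfl, hy⟩]
      · rw [if_neg (fun h' => hyx (congrArg Subtype.val h')), if_neg (fun h' => hyx h'.1)]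
    · have hvan : ∀ z, mlOpT (toKT i).NB ℓ (toKT i).k (cubeFamY i q).lev (wCube ℓ) y z * GpDirOneY i q z x = 0 := by
        intro z
        have h0 : GpDirOneY i q z x = 0 := GpDirOne_apply_of_not_mem_right _ hx
        rw [h0, mul_zero]
      rw [Finset.sum_eq_zero (fun z _ => hvan z), if_neg (fun h' : y = x ∧ y ∈ dirDomY i q => hx (h'.1 ▸ hy))]
  · rw [if_neg hy, if_neg (fun h' => hy h'.2)]

/-! ## §2  The compressed block word `X = Q′_□G′_□(1)²Q′*_□` and its Dirichlet inverse `K_X` (the `hKX` socket of g33, both orders, as padded laws) -/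

/-- the canonical block inverse `kxDirC` IS g33's explicit `K_X` (uniqueness of the inverse on `𝔖`, both zero off `𝔖 × 𝔖`).
[cite: Balaban1985BackgroundPropagators, (3.25) p.394, p.409 l.1–5; Balaban1983RegularityDecay, (2.42) p.584] -/
theorem kxDirC_eq_kxDirY : kxDirC i q = kxDirY i q := by
  have h := compr_eq_invOnB (insideBlkY i q (dirDomY i q)) (hKX_dirDomY i q)
  rw [kxDirC, ← h]
  ext s t
  rw [compr_apply]
  split_ifs with hst
  · rfl
  · exact (kxDirY_apply_of_not i q s t hst).symm

/-- `K_X` is already compressed: `𝟙_𝔖·K_X·𝟙_𝔖 = K_X`. [cite: Balaban1985BackgroundPropagators, p.409 l.1–5, bookkeeping] -/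
theorem compr_kxDirC :
    indDiagY (insideBlkY i q (dirDomY i q)) * kxDirC i q * indDiagY (insideBlkY i q (dirDomY i q)) = kxDirC i q := by
  rw [kxDirC]; exact compr_invOnB _ _

/-- `𝟙_𝔖·K_X = K_X`. [cite: Balaban1985BackgroundPropagators, p.409 l.1–5, bookkeeping] -/
theorem indDiagY_mul_kxDirC : indDiagY (insideBlkY i q (dirDomY i q)) * kxDirC i q = kxDirC i q := by
  conv_lhs => rw [← compr_kxDirC i q]
  rw [← Matrix.mul_assoc, ← Matrix.mul_assoc, indDiagY_mul_indDiagY, compr_kxDirC]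

/-- `K_X·𝟙_𝔖 = K_X`. [cite: Balaban1985BackgroundPropagators, p.409 l.1–5, bookkeeping] -/
theorem kxDirC_mul_indDiagY : kxDirC i q * indDiagY (insideBlkY i q (dirDomY i q)) = kxDirC i q := by
  conv_lhs => rw [← compr_kxDirC i q]
  rw [Matrix.mul_assoc, indDiagY_mul_indDiagY, compr_kxDirC]

/-- the compressed law `X|_𝔖 · K_X|_𝔖 = 1` for the canonical `K_X`. [cite: Balaban1985BackgroundPropagators, p.409 l.1–5; Balaban1984PropagatorsII, Prop. 2.3 p.238] -/
theorem compress_xDirMatY_mul_kxDirC :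
    (xDirMatY i q (dirDomY i q) (GpDirOneY i q)).submatrix (fun v : ↥(insideBlkY i q (dirDomY i q)) => (v : BlkCubeY i q))
        (fun v : ↥(insideBlkY i q (dirDomY i q)) => (v : BlkCubeY i q)) *
      (kxDirC i q).submatrix (fun v : ↥(insideBlkY i q (dirDomY i q)) => (v : BlkCubeY i q))
        (fun v : ↥(insideBlkY i q (dirDomY i q)) => (v : BlkCubeY i q)) = 1 := by
  rw [kxDirC_eq_kxDirY]; exact hKX_dirDomY i q

/-- ★ the PADDED laws `(𝟙_𝔖X𝟙_𝔖)·K_X = 𝟙_𝔖 = K_X·(𝟙_𝔖X𝟙_𝔖)`. [cite: Balaban1985BackgroundPropagators, (3.25) p.394, p.409 l.1–5; Balaban1984PropagatorsII, (2.17) p.225] -/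
theorem comprX_mul_kxDirC :
    indDiagY (insideBlkY i q (dirDomY i q)) * xDirMatY i q (dirDomY i q) (GpDirOneY i q) * indDiagY (insideBlkY i q (dirDomY i q)) * kxDirC i q =
      indDiagY (insideBlkY i q (dirDomY i q)) ∧
    kxDirC i q * (indDiagY (insideBlkY i q (dirDomY i q)) * xDirMatY i q (dirDomY i q) (GpDirOneY i q) * indDiagY (insideBlkY i q (dirDomY i q))) =
      indDiagY (insideBlkY i q (dirDomY i q)) := by
  have h1 := compr_mul_compr_eq_indDiagY (R := ℝ) _ (compress_xDirMatY_mul_kxDirC i q)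
  have h2 := compr_mul_compr_eq_indDiagY (R := ℝ) _ (mul_eq_one_comm.1 (compress_xDirMatY_mul_kxDirC i q))
  rw [compr_kxDirC] at h1 h2
  exact ⟨h1, h2⟩

/-- `K_X · X · K_X = K_X`. [cite: Balaban1984PropagatorsII, (2.17) p.225, bookkeeping] -/
theorem kxDirC_mul_X_mul_kxDirC :
    kxDirC i q * xDirMatY i q (dirDomY i q) (GpDirOneY i q) * kxDirC i q = kxDirC i q := by
  obtain ⟨-, h2⟩ := comprX_mul_kxDirC i q
  calc kxDirC i q * xDirMatY i q (dirDomY i q) (GpDirOneY i q) * kxDirC i q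
      = (kxDirC i q * indDiagY (insideBlkY i q (dirDomY i q))) * xDirMatY i q (dirDomY i q) (GpDirOneY i q) *
          (indDiagY (insideBlkY i q (dirDomY i q)) * kxDirC i q) := by rw [kxDirC_mul_indDiagY, indDiagY_mul_kxDirC]
    _ = kxDirC i q * (indDiagY (insideBlkY i q (dirDomY i q)) * xDirMatY i q (dirDomY i q) (GpDirOneY i q) *
          indDiagY (insideBlkY i q (dirDomY i q))) * kxDirC i q := by simp only [Matrix.mul_assoc]
    _ = kxDirC i q := by rw [h2, indDiagY_mul_kxDirC]

/-- the block weight matrix `D = diag(W)` of the cube family and its inverse. [cite: Balaban1984PropagatorsII, (2.69) p.235, dictionary] -/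
theorem diagW_mul_diagWinv :
    Matrix.diagonal (fun y : BlkCubeY i q => W (cubeFamY i q).toDomains y) * Matrix.diagonal (fun y => (W (cubeFamY i q).toDomains y)⁻¹) = 1 ∧
    Matrix.diagonal (fun y : BlkCubeY i q => (W (cubeFamY i q).toDomains y)⁻¹) * Matrix.diagonal (fun y => W (cubeFamY i q).toDomains y) = 1 := by
  have h : Matrix.diagonal (fun y : BlkCubeY i q => W (cubeFamY i q).toDomains y) * Matrix.diagonal (fun y => (W (cubeFamY i q).toDomains y)⁻¹) = 1 := by
    rw [Matrix.diagonal_mul_diagonal, ← Matrix.diagonal_one]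
    congr 1; funext y; exact mul_inv_cancel₀ (W_pos (cubeFamY i q).toDomains y).ne'
  exact ⟨h, mul_eq_one_comm.1 h⟩

/-- `X = Q′·G′·G′·Q′*` is `D`-symmetric: `Xᵀ·D = D·X` (`Q′*ᵀ = D·Q′`, `Q′ᵀ = Q′*·D⁻¹`, `G′ᵀ = G′`). [cite: Balaban1984PropagatorsII, (2.17) p.225, (2.69) p.235, bookkeeping] -/
theorem xDirMatY_transpose_mul_diagW :
    (xDirMatY i q (dirDomY i q) (GpDirOneY i q))ᵀ * Matrix.diagonal (fun y : BlkCubeY i q => W (cubeFamY i q).toDomains y) =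
      Matrix.diagonal (fun y : BlkCubeY i q => W (cubeFamY i q).toDomains y) * xDirMatY i q (dirDomY i q) (GpDirOneY i q) := by
  obtain ⟨-, hDiD⟩ := diagW_mul_diagWinv i q
  have hQt : (qpKc i q)ᵀ = qpsKc i q * Matrix.diagonal (fun y : BlkCubeY i q => (W (cubeFamY i q).toDomains y)⁻¹) := by
    show (QM (cubeFamY i q))ᵀ = QsM (cubeFamY i q) * _
    rw [QM_eq_diag_mul, Matrix.transpose_mul, Matrix.transpose_transpose, Matrix.diagonal_transpose]
  have hQst : (qpsKc i q)ᵀ = Matrix.diagonal (fun y : BlkCubeY i q => W (cubeFamY i q).toDomains y) * qpKc i q := QsM_transpose (cubeFamY i q)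
  rw [xDirMatY_dirDomY_eq, Matrix.transpose_mul, Matrix.transpose_mul, Matrix.transpose_mul, GpDirOneY_transpose, hQt, hQst]
  simp only [Matrix.mul_assoc]
  rw [hDiD, Matrix.mul_one]

/-- ★ `K_X` is `D`-symmetric: `K_Xᵀ·D = D·K_X` (uniqueness of the inverse against the `D`-symmetric `X`). [cite: Balaban1984PropagatorsII, (2.17) p.225 («orthogonal projection»), bookkeeping] -/
theorem kxDirC_transpose_mul_diagW :
    (kxDirC i q)ᵀ * Matrix.diagonal (fun y : BlkCubeY i q => W (cubeFamY i q).toDomains y) =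
      Matrix.diagonal (fun y : BlkCubeY i q => W (cubeFamY i q).toDomains y) * kxDirC i q := by
  obtain ⟨h1, h2⟩ := comprX_mul_kxDirC i q
  have hXt := xDirMatY_transpose_mul_diagW i q
  have hK1 := indDiagY_mul_kxDirC i q
  have hK2 := kxDirC_mul_indDiagY i q
  have hPD : (indDiagY (insideBlkY i q (dirDomY i q)) : Matrix (BlkCubeY i q) (BlkCubeY i q) ℝ) *
      Matrix.diagonal (fun y : BlkCubeY i q => W (cubeFamY i q).toDomains y) =
      Matrix.diagonal (fun y : BlkCubeY i q => W (cubeFamY i q).toDomains y) * indDiagY (insideBlkY i q (dirDomY i q)) := by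
    rw [indDiagY, Matrix.diagonal_mul_diagonal, Matrix.diagonal_mul_diagonal]
    congr 1; funext y; ring
  have hPt : (indDiagY (insideBlkY i q (dirDomY i q)) : Matrix (BlkCubeY i q) (BlkCubeY i q) ℝ)ᵀ = indDiagY (insideBlkY i q (dirDomY i q)) := by
    rw [indDiagY, Matrix.diagonal_transpose]
  generalize xDirMatY i q (dirDomY i q) (GpDirOneY i q) = X at h1 h2 hXt
  generalize (Matrix.diagonal fun y : BlkCubeY i q => W (cubeFamY i q).toDomains y) = D at hXt hPD ⊢
  generalize (indDiagY (insideBlkY i q (dirDomY i q)) : Matrix (BlkCubeY i q) (BlkCubeY i q) ℝ) = P at h1 h2 hK1 hK2 hPD hPt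
  generalize kxDirC i q = K at h1 h2 hK1 hK2 ⊢
  -- `(P X P)ᵀ D = D (P X P)`
  have hXct : (P * X * P)ᵀ * D = D * (P * X * P) := by
    rw [Matrix.transpose_mul, Matrix.transpose_mul, hPt]
    calc P * (Xᵀ * P) * D = P * Xᵀ * (P * D) := by simp only [Matrix.mul_assoc]
      _ = P * (Xᵀ * D) * P := by rw [hPD]; simp only [Matrix.mul_assoc]
      _ = P * (D * X) * P := by rw [hXt]
      _ = (P * D) * X * P := by simp only [Matrix.mul_assoc]
      _ = D * (P * X * P) := by rw [hPD]; simp only [Matrix.mul_assoc]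
  -- `Kᵀ P = Kᵀ`
  have hKt1 : Kᵀ * P = Kᵀ := by
    conv_rhs => rw [← hK1]
    rw [Matrix.transpose_mul, hPt]
  generalize P * X * P = Xc at h1 h2 hXct
  -- `(Kᵀ D − D K)·Xc = 0`
  have e1 : Kᵀ * D * Xc = P * D := by
    rw [Matrix.mul_assoc, ← hXct, ← Matrix.mul_assoc, ← Matrix.transpose_mul, h1, hPt]
  have e2 : D * K * Xc = D * P := by rw [Matrix.mul_assoc, h2]
  have hzero : (Kᵀ * D - D * K) * Xc = 0 := by rw [sub_mul, e1, e2, hPD, sub_self]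
  -- multiply by `K` on the right
  have e3 : (Kᵀ * D - D * K) * Xc * K = Kᵀ * D - D * K := by
    rw [Matrix.mul_assoc (Kᵀ * D - D * K) Xc K, h1, sub_mul, Matrix.mul_assoc Kᵀ D P, ← hPD, ← Matrix.mul_assoc Kᵀ P D, hKt1,
      Matrix.mul_assoc D K P, hK2]
  rw [hzero, Matrix.zero_mul] at e3
  exact sub_eq_zero.1 e3.symm

/-! ## §3  `P_□ = G′_□Q′*_□(Q′_□G′_□²Q′*_□)⁻¹Q′_□G′_□` at `U = 1` is a symmetric idempotent (print's «orthogonal projection», (3.21)∕(3.25)) -/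

/-- the flat matrix of `P_□(1)` at the canonical letters, compressions removed: `G′·Q′*·K_X·Q′·G′`. [cite: Balaban1985BackgroundPropagators, (3.25) p.394, p.409 l.3–5] -/
theorem pDirMatY_dirDomY_eq :
    pDirMatY i q (dirDomY i q) (GpDirOneY i q) (kxDirC i q) = GpDirOneY i q * qpsKc i q * kxDirC i q * qpKc i q * GpDirOneY i q := by
  rw [pDirMatY, compr_GpDirOneY, compr_kxDirC]

/-- ★ **`P_□(1)² = P_□(1)`**. [cite: Balaban1985BackgroundPropagators, (3.21) p.394 («R is an orthogonal projection»), (3.25) p.394; Balaban1984PropagatorsII, (2.17) p.225] -/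
theorem pDir_mul_pDir :
    pDirMatY i q (dirDomY i q) (GpDirOneY i q) (kxDirC i q) * pDirMatY i q (dirDomY i q) (GpDirOneY i q) (kxDirC i q) =
      pDirMatY i q (dirDomY i q) (GpDirOneY i q) (kxDirC i q) := by
  rw [pDirMatY_dirDomY_eq]
  have hX : qpKc i q * GpDirOneY i q * (GpDirOneY i q * qpsKc i q) = xDirMatY i q (dirDomY i q) (GpDirOneY i q) := by
    rw [xDirMatY_dirDomY_eq]; simp only [Matrix.mul_assoc]
  calc GpDirOneY i q * qpsKc i q * kxDirC i q * qpKc i q * GpDirOneY i q * (GpDirOneY i q * qpsKc i q * kxDirC i q * qpKc i q * GpDirOneY i q)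
      = GpDirOneY i q * qpsKc i q * (kxDirC i q * (qpKc i q * GpDirOneY i q * (GpDirOneY i q * qpsKc i q)) * kxDirC i q) * qpKc i q * GpDirOneY i q := by
        simp only [Matrix.mul_assoc]
    _ = GpDirOneY i q * qpsKc i q * kxDirC i q * qpKc i q * GpDirOneY i q := by rw [hX, kxDirC_mul_X_mul_kxDirC]

/-- ★ **`P_□(1)ᵀ = P_□(1)`**. [cite: Balaban1985BackgroundPropagators, (3.21) p.394 («orthogonal projection in the Hilbert space L²(Ω₀, g)»), (3.25) p.394; Balaban1984PropagatorsII, (2.17) p.225] -/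
theorem pDir_transpose :
    (pDirMatY i q (dirDomY i q) (GpDirOneY i q) (kxDirC i q))ᵀ = pDirMatY i q (dirDomY i q) (GpDirOneY i q) (kxDirC i q) := by
  obtain ⟨-, hDiD⟩ := diagW_mul_diagWinv i q
  have hQt : (qpKc i q)ᵀ = qpsKc i q * Matrix.diagonal (fun y : BlkCubeY i q => (W (cubeFamY i q).toDomains y)⁻¹) := by
    show (QM (cubeFamY i q))ᵀ = QsM (cubeFamY i q) * _
    rw [QM_eq_diag_mul, Matrix.transpose_mul, Matrix.transpose_transpose, Matrix.diagonal_transpose]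
  have hQst : (qpsKc i q)ᵀ = Matrix.diagonal (fun y : BlkCubeY i q => W (cubeFamY i q).toDomains y) * qpKc i q := QsM_transpose (cubeFamY i q)
  rw [pDirMatY_dirDomY_eq, Matrix.transpose_mul, Matrix.transpose_mul, Matrix.transpose_mul, Matrix.transpose_mul, GpDirOneY_transpose, hQt, hQst]
  calc GpDirOneY i q * (qpsKc i q * Matrix.diagonal (fun y : BlkCubeY i q => (W (cubeFamY i q).toDomains y)⁻¹) *
        ((kxDirC i q)ᵀ * (Matrix.diagonal (fun y : BlkCubeY i q => W (cubeFamY i q).toDomains y) * qpKc i q * GpDirOneY i q)))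
      = GpDirOneY i q * qpsKc i q * (Matrix.diagonal (fun y : BlkCubeY i q => (W (cubeFamY i q).toDomains y)⁻¹) *
          ((kxDirC i q)ᵀ * Matrix.diagonal (fun y : BlkCubeY i q => W (cubeFamY i q).toDomains y))) * qpKc i q * GpDirOneY i q := by
        simp only [Matrix.mul_assoc]
    _ = GpDirOneY i q * qpsKc i q * kxDirC i q * qpKc i q * GpDirOneY i q := by
        rw [kxDirC_transpose_mul_diagW, ← Matrix.mul_assoc (Matrix.diagonal _), hDiD, Matrix.one_mul]

/-! ## §4  The quadratic form of `M_□(1) = mDirC i □` -/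

/-- the weight kernel `a_□` acts diagonally: `(a_□·g)(ι) = w_□(ι)·g(ι)` (r05's `aKc_eq_diagonal`). [cite: Balaban1985BackgroundPropagators, (3.26) p.395; Balaban1984PropagatorsII, (2.16) p.225] -/
theorem aKc_mulVec (g : IBondCubeY i q → ℝ) : aKc i q *ᵥ g = fun ι => wCubeBond i q ι * g ι := by
  rw [aKc_eq_diagonal]
  funext ι
  rw [Matrix.mulVec_diagonal]

/-- `a_□ᵀ = a_□`. [cite: Balaban1984PropagatorsII, (2.16) p.225, bookkeeping] -/
theorem aKc_transpose : (aKc i q)ᵀ = aKc i q := by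
  rw [aKc_eq_diagonal, Matrix.diagonal_transpose]

/-- `∂ = (∂*)ᵀ` as flat kernels. [cite: Balaban1985BackgroundPropagators, (3.8) p.392, bookkeeping] -/
theorem gradK_eq_transpose : gradK i = (divK i)ᵀ := by
  rw [divK_eq_transpose, Matrix.transpose_transpose]

/-- `‖P_□f‖² = ⟨f, P_□f⟩` (`P_□` a symmetric idempotent). [cite: Balaban1985BackgroundPropagators, (3.21) p.394, bookkeeping] -/
theorem dotProduct_pDir_mulVec_self (f : SiteY i → ℝ) :
    (pDirMatY i q (dirDomY i q) (GpDirOneY i q) (kxDirC i q) *ᵥ f) ⬝ᵥ (pDirMatY i q (dirDomY i q) (GpDirOneY i q) (kxDirC i q) *ᵥ f) =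
      f ⬝ᵥ (pDirMatY i q (dirDomY i q) (GpDirOneY i q) (kxDirC i q) *ᵥ f) := by
  conv_lhs => rw [Matrix.dotProduct_mulVec, ← Matrix.mulVec_transpose, pDir_transpose, Matrix.mulVec_mulVec, pDir_mul_pDir]
  exact dotProduct_comm _ _

/-- ★ **THE QUADRATIC FORM OF `M_□(1)`**: `⟨v, M_□(1)v⟩ = ‖∂v‖² + ‖(1 − P_□)∂*v‖² + Σ_{𝔅_□} w_□(Q_□v)²` — print's (3.26) `Δ_a = Δ + DRD* + Q*aQ` with
`R = 1 − P_□` an orthogonal projection, read at `U = 1` on the cube sequence's letters. [cite: Balaban1985BackgroundPropagators, (3.26) p.395, (3.21) p.394, (3.25) p.394; Balaban1984PropagatorsII, (2.18)–(2.19) p.226] -/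
theorem dotProduct_mDirC_mulVec (v : FBondY i → ℝ) :
    v ⬝ᵥ (mDirC i q *ᵥ v) =
      (curlK i *ᵥ v) ⬝ᵥ (curlK i *ᵥ v) +
      (divK i *ᵥ v - pDirMatY i q (dirDomY i q) (GpDirOneY i q) (kxDirC i q) *ᵥ (divK i *ᵥ v)) ⬝ᵥ
        (divK i *ᵥ v - pDirMatY i q (dirDomY i q) (GpDirOneY i q) (kxDirC i q) *ᵥ (divK i *ᵥ v)) +
      ∑ ι, wCubeBond i q ι * (qKc i q *ᵥ v) ι ^ 2 := by
  have hPP := dotProduct_pDir_mulVec_self i q (divK i *ᵥ v)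
  -- unfold `M_□(1)`
  rw [mDirC, mlocDirCMatY, deltaLocCubeMatY, Matrix.sub_mulVec, Matrix.add_mulVec, Matrix.add_mulVec, dotProduct_sub, dotProduct_add,
    dotProduct_add]
  simp only [← Matrix.mulVec_mulVec]
  -- the four terms
  have t1 : v ⬝ᵥ (cocurlK i *ᵥ (curlK i *ᵥ v)) = (curlK i *ᵥ v) ⬝ᵥ (curlK i *ᵥ v) := by
    rw [Matrix.dotProduct_mulVec, cocurlK_eq_transpose, Matrix.vecMul_transpose]
  have t2 : v ⬝ᵥ (gradK i *ᵥ (divK i *ᵥ v)) = (divK i *ᵥ v) ⬝ᵥ (divK i *ᵥ v) := by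
    rw [Matrix.dotProduct_mulVec, gradK_eq_transpose, Matrix.vecMul_transpose]
  have t3 : v ⬝ᵥ (qsKc i q *ᵥ (aKc i q *ᵥ (qKc i q *ᵥ v))) = ∑ ι, wCubeBond i q ι * (qKc i q *ᵥ v) ι ^ 2 := by
    rw [Matrix.dotProduct_mulVec, qsKc_eq_transpose, Matrix.vecMul_transpose, aKc_mulVec, dotProduct]
    exact Finset.sum_congr rfl fun ι _ => by ring
  have t4 : v ⬝ᵥ (gradK i *ᵥ (pDirMatY i q (dirDomY i q) (GpDirOneY i q) (kxDirC i q) *ᵥ (divK i *ᵥ v))) =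
      (divK i *ᵥ v) ⬝ᵥ (pDirMatY i q (dirDomY i q) (GpDirOneY i q) (kxDirC i q) *ᵥ (divK i *ᵥ v)) := by
    rw [Matrix.dotProduct_mulVec, gradK_eq_transpose, Matrix.vecMul_transpose]
  rw [t1, t2, t3, t4, sub_dotProduct, dotProduct_sub, dotProduct_sub,
    dotProduct_comm (pDirMatY i q (dirDomY i q) (GpDirOneY i q) (kxDirC i q) *ᵥ (divK i *ᵥ v)) (divK i *ᵥ v), hPP]
  ring

/-- `⟨v, M_□(1)v⟩ ≥ 0` (the weights are positive for `b₀ > 0`). [cite: Balaban1985BackgroundPropagators, p.395 («the operator Δ′_a is positive … hence the existence of the operator R»), (3.26) p.395] -/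
theorem dotProduct_mDirC_mulVec_nonneg (hb₀ : 0 < b₀) (v : FBondY i → ℝ) : 0 ≤ v ⬝ᵥ (mDirC i q *ᵥ v) := by
  rw [dotProduct_mDirC_mulVec]
  refine add_nonneg (add_nonneg (Finset.sum_nonneg fun _ _ => mul_self_nonneg _) (Finset.sum_nonneg fun _ _ => mul_self_nonneg _))
    (Finset.sum_nonneg fun ι _ => mul_nonneg (wCubeBond_pos i q hb₀ ι).le (sq_nonneg _))

/-- `M_□(1)ᵀ = M_□(1)`. [cite: Balaban1985BackgroundPropagators, (3.26) p.395, bookkeeping] -/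
theorem mDirC_transpose : (mDirC i q)ᵀ = mDirC i q := by
  rw [mDirC, mlocDirCMatY, deltaLocCubeMatY, Matrix.transpose_sub, Matrix.transpose_add, Matrix.transpose_add, Matrix.transpose_mul,
    Matrix.transpose_mul, Matrix.transpose_mul, Matrix.transpose_mul, Matrix.transpose_mul, Matrix.transpose_mul, pDir_transpose, aKc_transpose,
    ← cocurlK_eq_transpose, ← divK_eq_transpose, ← qsKc_eq_transpose, ← gradK_eq_transpose]
  rw [show (cocurlK i)ᵀ = curlK i by rw [cocurlK_eq_transpose, Matrix.transpose_transpose],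
    show (qsKc i q)ᵀ = qKc i q by rw [qsKc_eq_transpose, Matrix.transpose_transpose]]
  simp only [Matrix.mul_assoc]

/-! ## §5  The kernel of `M_□(1)` is trivial: [4] Sect. A's zero modes for the CUBE family, and the Dirichlet `R_□`-condition -/

/-- `Q_□v = 0` iff the homogeneous constraints (2.6) of the cube sequence hold. [cite: Balaban1984PropagatorsII, (2.6) p.224, (2.20) p.226; Balaban1985BackgroundPropagators, p.408] -/
theorem qKc_mulVec_eq_zero_iff (f : FBondY i → ℝ) :
    qKc i q *ᵥ f = 0 ↔ ∀ (j : ℕ) (b : PBond (PV d ℓ i.m i.K hd hL) j), (domCube i q).LamBond j b → bondAvgIter j f b = 0 := by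
  have h : qKc i q *ᵥ f = fun x => (QE (domCube i q) (WithLp.toLp 2 f)).ofLp x := by
    funext x
    simp only [qKc, LinearMap.toMatrix'_mulVec, onFun_apply]
  rw [h, ← QE_eq_zero_iff (domCube i q) (WithLp.toLp 2 f), WithLp.ofLp_toLp]
  constructor
  · intro h0
    ext x
    exact congrFun h0 x
  · intro h0
    funext x
    rw [h0]
    rfl

/-- ★ **ZERO MODES OF THE CUBE SEQUENCE, SUPPORTED**: a curl-free bond field with `Q_□v = 0` is the gradient of a potential `φ ∈ N(Q′_□)` (r03's
`exists_inGauge_grad_of_curl_eq_zero` for `domCube`), and `φ` VANISHES OFF `Ω₀(□)` — the potential vanishes on the level-`0` exterior `Λ₀(□)` ((2.7) «λ = 0 on Λ₀»)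
and every site of positive cube level lies in `Ω₀(□)` (g31's `mem_dirDomC_of_lev_pos`). [cite: Balaban1984PropagatorsII, (2.7) p.224 («λ = 0 on Λ₀, Q′_jλ = 0 on Λ_j»), (2.21) p.226; Balaban1985BackgroundPropagators, p.394 («the functions λ … vanish on Ω₁ᶜ»), p.408] -/
theorem exists_potential_of_curlK_qKc {v : FBondY i → ℝ} (hcurl : curlK i *ᵥ v = 0) (hq : qKc i q *ᵥ v = 0) :
    ∃ φ : SiteY i → ℝ, QB (cubeFamY i q).toDomains φ = 0 ∧ gradK i *ᵥ φ = v ∧ ∀ z, z ∉ dirDomY i q → φ z = 0 := by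
  have hc : curl i.cf v = 0 := by rw [← curlK_mulVec]; exact hcurl
  have hA := (qKc_mulVec_eq_zero_iff i q v).1 hq
  obtain ⟨φ₀, hφ₀, hv⟩ := exists_inGauge_grad_of_curl_eq_zero (domCube i q) i.hcf hc hA
  have hcomp : (fun x => φ₀ ((chartY i).symm (toBox i.hN x))) = φ₀ :=
    funext fun x => congrArg φ₀ ((chartY i).symm_apply_apply x)
  refine ⟨fun z => φ₀ ((chartY i).symm z), ?_, ?_, ?_⟩
  · refine (B6ScalarChartV1L0.inGauge_chart_iff i.hN (cubeFamY i q) i.hk (fun z => φ₀ ((chartY i).symm z))).1 ?_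
    rw [← hcomp] at hφ₀
    exact hφ₀
  · rw [gradK_mulVec_chart, hv]
  · intro z hz
    have hlev : (cubeFamY i q).lev ((z : SiteY i) : Fin (d + 1) → ℤ) = 0 := by
      by_contra hne
      exact hz (mem_dirDomC_of_lev_pos hL.1 (oddMh i) (toKT i).hMh (toKT i).hP q (Nat.one_le_iff_ne_zero.2 hne))
    have hLam : (domCube i q).LamSite 0 (iterBlockOf 0 ((chartY i).symm z)) := by
      rw [B6ScalarChartV1L0.lamSite_domT_iff i.hN (cubeFamY i q) i.hk 0 ((chartY i).symm z)]
      have : toBox i.hN ((chartY i).symm z) = z := toBox_boxEquiv_symm i.hN z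
      rw [this]
      exact hlev
    have h0 := hφ₀ 0 _ hLam
    rw [iterBlockOf_zero] at h0
    exact h0

/-- `φ = 𝟙_{Ω₀}φ` for a potential supported in `Ω₀(□)`. [cite: Balaban1985BackgroundPropagators, p.394, bookkeeping] -/
theorem indDiagY_mulVec_of_support {S : Finset (SiteY i)} {φ : SiteY i → ℝ} (hφ : ∀ z, z ∉ S → φ z = 0) :
    indDiagY S *ᵥ φ = φ := by
  funext z
  rw [indDiagY_mulVec_apply]
  split_ifs with hz
  · rfl
  · exact (hφ z hz).symm

/-- `⟨𝟙_S·φ, g⟩ = ⟨φ, 𝟙_S·g⟩`. [cite: Balaban1985BackgroundPropagators, p.394, bookkeeping] -/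
theorem dotProduct_indDiagY_mulVec (S : Finset (SiteY i)) (φ g : SiteY i → ℝ) :
    (indDiagY S *ᵥ φ) ⬝ᵥ g = φ ⬝ᵥ (indDiagY S *ᵥ g) := by
  rw [Matrix.dotProduct_mulVec, ← Matrix.mulVec_transpose, indDiagY, Matrix.diagonal_transpose]

/-- ★★ **THE KERNEL OF `M_□(1)` IS TRIVIAL**: `⟨v, M_□(1)v⟩ = 0 ⇒ v = 0`.  The three squares vanish: `∂v = 0`, `Q_□v = 0`, `P_□(∂*v) = ∂*v`; so `v = ∂φ`
with `φ ∈ N(Q′_□)` supported in `Ω₀(□)`; then `∂*v = c_f²Δ′_{a,□}(1)φ`, and `∂*v ∈ range P_□ = G′_□(1)·range(Q′*_□)` is `⟨·, ·⟩`-orthogonal to `φ` (block means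
of `φ` vanish) while `⟨φ, ∂*v⟩ = c_f²‖Δ′_{a,□}(1)φ‖²·c_f⁻²…` — precisely `⟨φ, Δ′_{a,□}(1)∂*v⟩`-bookkeeping with `𝟙_{Ω₀}Δ′_{a,□}(1)G′_□(1) = 𝟙_{Ω₀}` gives
`‖Δ′_{a,□}(1)φ‖ = 0`, hence `φ = 0` (`Δ′_{a,□}(1)` injective) and `v = 0`. [cite: Balaban1985BackgroundPropagators, p.395 («Δ′_a is positive. This implies positivity of the operators G′, Q′G′²Q′*, hence the existence of the operator R»), (3.26)–(3.27) p.395, Cor. 3.5 p.407 («for U = 1 … proved in [4]»); Balaban1984PropagatorsII, p.226 («Δ_a is bounded from below by a positive constant»), (2.21)–(2.22) p.226] -/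
theorem eq_zero_of_dotProduct_mDirC_mulVec_eq_zero (hb₀ : 0 < b₀) {v : FBondY i → ℝ} (h : v ⬝ᵥ (mDirC i q *ᵥ v) = 0) : v = 0 := by
  classical
  have hℓ : 1 ≤ ℓ := by have := hL.2; omega
  have hq := dotProduct_mDirC_mulVec i q v
  rw [h] at hq
  -- the three squares vanish
  have n1 : 0 ≤ (curlK i *ᵥ v) ⬝ᵥ (curlK i *ᵥ v) := Finset.sum_nonneg fun _ _ => mul_self_nonneg _
  have n2 : 0 ≤ (divK i *ᵥ v - pDirMatY i q (dirDomY i q) (GpDirOneY i q) (kxDirC i q) *ᵥ (divK i *ᵥ v)) ⬝ᵥ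
      (divK i *ᵥ v - pDirMatY i q (dirDomY i q) (GpDirOneY i q) (kxDirC i q) *ᵥ (divK i *ᵥ v)) := Finset.sum_nonneg fun _ _ => mul_self_nonneg _
  have n3 : 0 ≤ ∑ ι, wCubeBond i q ι * (qKc i q *ᵥ v) ι ^ 2 := Finset.sum_nonneg fun ι _ => mul_nonneg (wCubeBond_pos i q hb₀ ι).le (sq_nonneg _)
  have z1 : (curlK i *ᵥ v) ⬝ᵥ (curlK i *ᵥ v) = 0 := by linarith
  have z2 : (divK i *ᵥ v - pDirMatY i q (dirDomY i q) (GpDirOneY i q) (kxDirC i q) *ᵥ (divK i *ᵥ v)) ⬝ᵥ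
      (divK i *ᵥ v - pDirMatY i q (dirDomY i q) (GpDirOneY i q) (kxDirC i q) *ᵥ (divK i *ᵥ v)) = 0 := by linarith
  have z3 : ∑ ι, wCubeBond i q ι * (qKc i q *ᵥ v) ι ^ 2 = 0 := by linarith
  have hcurl : curlK i *ᵥ v = 0 := dotProduct_self_eq_zero.1 z1
  have hP : pDirMatY i q (dirDomY i q) (GpDirOneY i q) (kxDirC i q) *ᵥ (divK i *ᵥ v) = divK i *ᵥ v := by
    have := dotProduct_self_eq_zero.1 z2
    exact (sub_eq_zero.1 this).symm
  have hQ : qKc i q *ᵥ v = 0 := by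
    funext ι
    have hι := (Finset.sum_eq_zero_iff_of_nonneg fun ι _ => mul_nonneg (wCubeBond_pos i q hb₀ ι).le (sq_nonneg _)).1 z3 ι (Finset.mem_univ ι)
    rcases mul_eq_zero.1 hι with h0 | h0
    · exact absurd h0 (wCubeBond_pos i q hb₀ ι).ne'
    · exact pow_eq_zero_iff two_ne_zero |>.1 h0
  -- the potential
  obtain ⟨φ, hφQ, hφv, hφS⟩ := exists_potential_of_curlK_qKc i q hcurl hQ
  -- `∂*v = c_f²·Δ′_{a,□}(1)φ`
  have hf : divK i *ᵥ v = i.cf ^ 2 • (mlOpT (toKT i).NB ℓ (toKT i).k (cubeFamY i q).lev (wCube ℓ) *ᵥ φ) := by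
    rw [← hφv, divK_gradK_mulVec, B6ScalarChartV1L0.mlOpT_mulVec_of_QB_eq_zero (cubeFamY i q) (wCube ℓ) hφQ]
    rfl
  -- `∂*v = G′_□(1)·g` with `g ∈ range Q′*_□`
  generalize divK i *ᵥ v = f at hP hf
  obtain ⟨g, hgdef⟩ : ∃ g : SiteY i → ℝ, qpsKc i q *ᵥ (kxDirC i q *ᵥ (qpKc i q *ᵥ (GpDirOneY i q *ᵥ f))) = g := ⟨_, rfl⟩
  have hPg : f = GpDirOneY i q *ᵥ g := by
    rw [← hgdef]
    conv_lhs => rw [← hP, pDirMatY_dirDomY_eq]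
    simp only [← Matrix.mulVec_mulVec]
  -- `⟨φ, g⟩ = 0` (block means of `φ` vanish)
  have hφg : φ ⬝ᵥ g = 0 := by
    rw [← hgdef, Matrix.dotProduct_mulVec, ← Matrix.mulVec_transpose]
    rw [show (qpsKc i q)ᵀ = Matrix.diagonal (fun y : BlkCubeY i q => W (cubeFamY i q).toDomains y) * qpKc i q from QsM_transpose (cubeFamY i q),
      ← Matrix.mulVec_mulVec, show qpKc i q *ᵥ φ = QB (cubeFamY i q).toDomains φ from (QB_eq_QM_mulVec (cubeFamY i q) φ).symm, hφQ,
      Matrix.mulVec_zero, zero_dotProduct]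
  -- `⟨φ, g⟩ = ⟨φ, 𝟙_{Ω₀}Δ′_{a,□}(1)G′_□(1)g⟩ = ⟨φ, Δ′_{a,□}(1)f⟩ = ⟨Δ′_{a,□}(1)φ, f⟩`
  have hφg' : φ ⬝ᵥ g = (mlOpT (toKT i).NB ℓ (toKT i).k (cubeFamY i q).lev (wCube ℓ) *ᵥ φ) ⬝ᵥ f := by
    have e1 : φ ⬝ᵥ g = φ ⬝ᵥ (indDiagY (dirDomY i q) *ᵥ g) := by
      rw [← dotProduct_indDiagY_mulVec, indDiagY_mulVec_of_support i hφS]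
    have e2 : indDiagY (dirDomY i q) *ᵥ g = indDiagY (dirDomY i q) *ᵥ (mlOpT (toKT i).NB ℓ (toKT i).k (cubeFamY i q).lev (wCube ℓ) *ᵥ f) := by
      rw [hPg, Matrix.mulVec_mulVec, Matrix.mulVec_mulVec, Matrix.mul_assoc, indDiagY_mul_mSite_mul_GpDirOneY]
    have e3 : φ ⬝ᵥ (indDiagY (dirDomY i q) *ᵥ (mlOpT (toKT i).NB ℓ (toKT i).k (cubeFamY i q).lev (wCube ℓ) *ᵥ f)) =
        φ ⬝ᵥ (mlOpT (toKT i).NB ℓ (toKT i).k (cubeFamY i q).lev (wCube ℓ) *ᵥ f) := by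
      rw [← dotProduct_indDiagY_mulVec, indDiagY_mulVec_of_support i hφS]
    rw [e1, e2, e3, Matrix.dotProduct_mulVec, ← Matrix.mulVec_transpose, mSite_transpose]
  -- hence `c_f²‖Δ′_{a,□}(1)φ‖² = 0`
  have hsq : i.cf ^ 2 * ((mlOpT (toKT i).NB ℓ (toKT i).k (cubeFamY i q).lev (wCube ℓ) *ᵥ φ) ⬝ᵥ
      (mlOpT (toKT i).NB ℓ (toKT i).k (cubeFamY i q).lev (wCube ℓ) *ᵥ φ)) = 0 := by
    have := hφg'
    rw [hφg, hf, dotProduct_smul, smul_eq_mul] at this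
    exact this.symm
  have hcf2 : i.cf ^ 2 ≠ 0 := pow_ne_zero 2 i.hcf
  have hMφ : mlOpT (toKT i).NB ℓ (toKT i).k (cubeFamY i q).lev (wCube ℓ) *ᵥ φ = 0 :=
    dotProduct_self_eq_zero.1 ((mul_eq_zero.1 hsq).resolve_left hcf2)
  have hφ0 : φ = 0 := by
    refine mlOpT_mulVec_injective (ℓ := ℓ) (lev := (cubeFamY i q).lev) (a := wCube ℓ) (one_le_N0 (toKT i).hMh (toKT i).hP) (cubeFamY i q).lev_le
      (wCube_pos hℓ) ?_
    rw [hMφ, Matrix.mulVec_zero]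
  rw [← hφv, hφ0, Matrix.mulVec_zero]

/-- ★★ **`M_□(1)` IS POSITIVE DEFINITE** on all bond functions of the member torus (print: «it can be easily shown that the operator Δ′_a is positive. This implies
positivity of the operators G′, Q′G′²Q′*, hence the existence of the operator R», and G = (Δ_a↾Ω₀)⁻¹ exists at `U = 1`, «proved in [4]»).
[cite: Balaban1985BackgroundPropagators, p.395, (3.27) p.395, Cor. 3.5 p.407, p.409 l.3–5; Balaban1984PropagatorsII, p.226, p.228 («The only assumption we have used was the positivity of the operator Δ_a»)] -/
theorem mDirC_posDef (hb₀ : 0 < b₀) : (mDirC i q).PosDef := by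
  refine Matrix.PosDef.of_dotProduct_mulVec_pos ?_ (fun v hv => ?_)
  · show (mDirC i q)ᴴ = mDirC i q
    rw [Matrix.conjTranspose_eq_transpose_of_trivial, mDirC_transpose]
  · rw [star_trivial]
    rcases (dotProduct_mDirC_mulVec_nonneg i q hb₀ v).lt_or_eq with h | h
    · exact h
    · exact absurd (eq_zero_of_dotProduct_mDirC_mulVec_eq_zero i q hb₀ h.symm) hv

/-! ## §6  ★★★ THE BOND SOCKET `hKB` DISCHARGED: `M_□(1)|_{B×B} · K_B|_{B×B} = 1` on `B = bondsOverY Ω₀(□)` with `K_B := kDirC i □` -/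

/-- every principal compression of `M_□(1)` is positive definite. [cite: Balaban1985BackgroundPropagators, (3.27) p.395 («G = (Δ_a↾Ω₀)⁻¹»), p.409 l.3–5] -/
theorem compress_mDirC_posDef (hb₀ : 0 < b₀) (B : Finset (FBondY i)) :
    ((mDirC i q).submatrix (fun v : ↥B => (v : FBondY i)) (fun v : ↥B => (v : FBondY i))).PosDef :=
  (mDirC_posDef i q hb₀).submatrix Subtype.val_injective

/-- ★★★ **THE SOCKET `hKB` OF ROAD (B5) AT `K_B := kDirC i □`**: the compression of print's `U = 1` Dirichlet bond operator of the cube sequence to the bonds over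
`Ω₀(□)` is inverted by the canonical kernel — `M_□(1)|_{B×B}·(kDirC i □)|_{B×B} = 1`, `B = bondsOverY Ω₀(□)`; this is LITERALLY the hypothesis `hKB` of
✓`B9Cor35GDirInputsAtOne.thm33_GdK_cube_of_prop26Dirichlet`, ✓`B9Cor36GDirKnitAtCutField.gDir_knit_at_cutField`, ✓`B9Cor36GDirKnitRowsAtMemberY.cubeRowsGDirCY_at_member`.
[cite: Balaban1985BackgroundPropagators, (3.27) p.395 («G(U) = G = (Δ_a↾Ω₀)⁻¹»), p.409 l.3–5 («G_□(U)»), Cor. 3.5 p.407 («for U = 1 … proved in [4]»); Balaban1984PropagatorsII, (2.22) p.226, p.228 («G(Ω) = (ΩΔ_aΩ)⁻¹»)] -/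
theorem compress_mDirC_mul_kDirC (hb₀ : 0 < b₀) :
    (mDirC i q).submatrix (fun v : ↥(bondsOverY i (dirDomY i q)) => (v : FBondY i)) (fun v : ↥(bondsOverY i (dirDomY i q)) => (v : FBondY i)) *
      (kDirC i q).submatrix (fun v : ↥(bondsOverY i (dirDomY i q)) => (v : FBondY i)) (fun v : ↥(bondsOverY i (dirDomY i q)) => (v : FBondY i)) = 1 := by
  classical
  have hU := (compress_mDirC_posDef i q hb₀ (bondsOverY i (dirDomY i q))).isUnit
  have hK : (kDirC i q).submatrix (fun v : ↥(bondsOverY i (dirDomY i q)) => (v : FBondY i)) (fun v : ↥(bondsOverY i (dirDomY i q)) => (v : FBondY i)) =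
      ((mDirC i q).submatrix (fun v : ↥(bondsOverY i (dirDomY i q)) => (v : FBondY i)) (fun v : ↥(bondsOverY i (dirDomY i q)) => (v : FBondY i)))⁻¹ := by
    ext a b
    rw [Matrix.submatrix_apply, kDirC, invOnB_apply_of_mem _ _ a.2 b.2]
  rw [hK, Matrix.mul_nonsing_inv _ ((Matrix.isUnit_iff_isUnit_det _).1 hU)]

/-- the other order: `(kDirC i □)|_{B×B}·M_□(1)|_{B×B} = 1`. [cite: Balaban1985BackgroundPropagators, (3.27) p.395, p.409 l.3–5] -/
theorem compress_kDirC_mul_mDirC (hb₀ : 0 < b₀) :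
    (kDirC i q).submatrix (fun v : ↥(bondsOverY i (dirDomY i q)) => (v : FBondY i)) (fun v : ↥(bondsOverY i (dirDomY i q)) => (v : FBondY i)) *
      (mDirC i q).submatrix (fun v : ↥(bondsOverY i (dirDomY i q)) => (v : FBondY i)) (fun v : ↥(bondsOverY i (dirDomY i q)) => (v : FBondY i)) = 1 :=
  mul_eq_one_comm.1 (compress_mDirC_mul_kDirC i q hb₀)

/-- ★ **THE BOND SOCKET IN THE HEADS' `∃`-SHAPE**: at every cover cube there is a real `K_B` inverting the compression of `mDirC i □` to `bondsOverY Ω₀(□)`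
(F6's hypothesis, per member `i := x.toKIdx`). [cite: Balaban1985BackgroundPropagators, (3.27) p.395, p.409 l.3–5, Cor. 3.6 p.408; Balaban1984PropagatorsII, (2.21)–(2.22) p.226] -/
theorem exists_bondSocket (hb₀ : 0 < b₀) :
    ∀ c' : ↥(cubes (toKT i).D.toDomains), ∃ KB : Matrix (FBondY i) (FBondY i) ℝ,
      (mDirC i c').submatrix (fun v : ↥(bondsOverY i (dirDomY i c')) => (v : FBondY i)) (fun v : ↥(bondsOverY i (dirDomY i c')) => (v : FBondY i)) *
        KB.submatrix (fun v : ↥(bondsOverY i (dirDomY i c')) => (v : FBondY i)) (fun v : ↥(bondsOverY i (dirDomY i c')) => (v : FBondY i)) = 1 :=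
  fun c' => ⟨kDirC i c', compress_mDirC_mul_kDirC i c' hb₀⟩

end Literature.MathematicalPhysics.QuantumFieldTheory.Balaban1983to89.B9CubeDirInverseBondSocketAtOne

end
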